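import Literature.NumberTheory.Automorphic.CompactQuotientFiniteMultiplicity
import HarnessLib

/-!
# FLOOR-0 ENGINE T1, line `F0_T1InnerFormTraceIdentity` — anchor fact A2 `FactT1aMultiplicityFinite` HOLDS (by-name fold)

Cell hodgecm-mathlib, FLOOR 0, crux item H413 = stmt-HodgeConjecture-24833; line `Cruxes/H413/Lines/F0_T1InnerFormTraceIdentity.lean`
(ed. 1.3–1.8), anchor fact **A2** `FactT1aMultiplicityFinite L H μ` (§4 there): for anisotropic `H ∈ M₃(L)` over a CM field `L` every
discrete automorphic representation of `U(H)(𝔸_{L⁺})` occurs in `L²(U(H)(L⁺)\U(H)(𝔸_{L⁺}), μ)` with FINITE multiplicity.  The tree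
PROVES it (★ `UnitaryGroup.multiplicity_lt_top_of_mem_discreteSpectrum_cmDatum`, `CompactQuotientFiniteMultiplicity.lean`;
Deitmar–Echterhoff Thm. 9.2.2 ∕ Gelfand–Graev–Piatetski-Shapiro Ch. 1 §2.3), but the line editions carried A2 as a BY-NAME HYPOTHESIS
because the farm snapshot had that module unbuilt (rc 75 at 2026-08-30T22:02Z, 22:36Z).  This file is the rider (b) of brief B1
(F0P3a-p01 (g0)): the one-line proof of A2's body VERBATIM, stated binder for binder (token-identical to the body of
`…Cruxes.H413.F0T1InnerFormTraceIdentity.FactT1aMultiplicityFinite`; the Lines module is not imported), so that the next line edition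
folds `theorem factT1a_multiplicityFinite : FactT1aMultiplicityFinite L H μ := F0P3aFactA2MultiplicityFinite.factA2_holds L H μ` and drops
the hypothesis `hA2` of `engineT1_of_stubs`; proposing it also makes the gate BUILD `CompactQuotientFiniteMultiplicity` on the farm.

HONEST LABEL: HC_CM is proved only modulo the printed citations until rung 0 closes; this closes no stub (A2 was never a stub) and moves
no floor.

## References
* [DeitmarEchterhoff2014] A. Deitmar, S. Echterhoff, *Principles of Harmonic Analysis*, 2nd ed. (2014), Thm. 9.2.2.
* [GelfandGraevPiatetskiShapiro1969] I. M. Gelfand, M. I. Graev, I. I. Piatetski-Shapiro (1969), Ch. 1 §2.3.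
* [Rogawski1990] J. Rogawski, Ann. of Math. Stud. 123 (1990), §14.5 p. 237 (print).
-/

set_option autoImplicit false
set_option linter.dupNamespace false

noncomputable section

namespace Summit.HodgeConjecture.HodgeConjecture.Cruxes.H413.F0P3aFactA2MultiplicityFinite

open MeasureTheory Measure NumberField IsDedekindDomain
open Literature.NumberTheory.Automorphic
open Literature.AlgebraicGeometry.ShimuraVarieties (hermForm)

variable (L : Type) [Field L] [NumberField L] [IsCMField L] (H : Matrix (Fin 3) (Fin 3) L)
  (μ : Measure (UnitaryGroup.cmDatum L 3 H).automorphicQuotient) [(UnitaryGroup.cmDatum L 3 H).IsAutomorphicMeasure μ]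

/-- **Anchor fact A2 of line `F0_T1InnerFormTraceIdentity` HOLDS** — the body of `FactT1aMultiplicityFinite L H μ` binder for binder:
for anisotropic `H`, finite multiplicities in `L²` of the compact quotient `U(H)(L⁺)\U(H)(𝔸_{L⁺})`
(★ `UnitaryGroup.multiplicity_lt_top_of_mem_discreteSpectrum_cmDatum`: compact operators `R(f)` commute with the commutant and do
not all kill a non-zero closed invariant subspace). [cite: DeitmarEchterhoff2014, Thm. 9.2.2] [cite: Rogawski1990, §14.5 p. 237] -/
theorem factA2_holds :
    (∀ x : Fin 3 → L, hermForm (cmConjRingHom L) H x x = 0 → x = 0) →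
      multiplicity_lt_top_of_mem_discreteSpectrum (UnitaryGroup.cmDatum L 3 H) μ :=
  fun hanis => UnitaryGroup.multiplicity_lt_top_of_mem_discreteSpectrum_cmDatum L 3 H hanis μ

end Summit.HodgeConjecture.HodgeConjecture.Cruxes.H413.F0P3aFactA2MultiplicityFinite

end
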